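import Summits.CriticalPhenomena.CardyFormulaZ2.Theorems.CardyIKTransportIKLinearTransportWallDominationH1Gen
import Summits.CriticalPhenomena.CardyFormulaZ2.Theorems.CardyIKTransportIKLinearTransportWallDominationLinkConst
import Summits.CriticalPhenomena.CardyFormulaZ2.Theorems.CardyIKTransportIKLinearTransportWallDominationPerm
import Summits.CriticalPhenomena.CardyFormulaZ2.Theorems.CardyIKTransportIKLinearTransportWallDominationLastColMono
import Summits.CriticalPhenomena.CardyFormulaZ2.Theorems.CardyIKTransportIKLinearTransportWallDominationOneWall
import Summits.CriticalPhenomena.CardyFormulaZ2.Theorems.CardyIKTransportIKLinearTransportWallDominationProduct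
import Summits.CriticalPhenomena.CardyFormulaZ2.Theorems.CardyIKTransportIKLinearTransportWallDominationRot
import Summits.CriticalPhenomena.CardyFormulaZ2.Theorems.CardyIKTransportIKLinearTransportWallDominationTwoWall

/-!
# `CardyIKTransport.IKLinearTransport` (stmt-CriticalPhenomena-5076), line `pinned-diagram-exchange`, lead c8 —
# WALL DOMINATION (an FKG substitute across a column for the column-mixed Izergin–Korepin gauge): THE ASSEMBLY

Support file (`--supports stmt-CriticalPhenomena-5076`; registered sub-goals `oneWallDomination`, `twoWallDomination`).  Sorry-free
assembly of the wave-c8 files: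

* `oneWallDomination : OneWallDomination` — on the cylinder slab `Fin (w+1) × ℤ/L` (`L ≥ 3`) with ANY face-type pattern `τ`, every
  WALL-MONOTONE event (an increasing function of the black-connectivity profile of the wall column `0`, cut down by any event of
  the wall colouring — so in particular CONDITIONALLY on the wall colouring) has probability at least its all-honeycomb
  (site-`𝕋`) probability.  Chain: `stub_h1Gen` (p154959, path surgery for arbitrary old cells) + `stub_linkConstGen` (p154844) ⟹
  `stub_lastColMonoGen` (p154971, the pointwise heart: the sister line's gap-crossing domination `LinkTraceIneq`/`LinkTelescope` for
  the upward closure of the event) ⟹ `stub_lastFaceMonoGen` (p155002, Fubini) ⟹ with `stub_permInvariance` (p154865, `CylExchange`)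
  and `stub_wallMonotoneOffCol` (p154844) `stub_oneWallDomination_of` (p155002, induction on the number of isotropic face columns).
* `twoWallDomination : TwoWallDomination` — on the cylinder slab of `w₁ + w₂` face columns with ANY pattern, every event increasing
  in the PAIR (left profile, right profile) of the middle cell column `w₁` has probability at least its all-honeycomb probability:
  `stub_twoWallOfOne` (p155039: iterated sums over `stub_productStructure`, one-wall domination fibre by fibre on the right, the
  rotated one — `stub_rotInvariance` — on the left).

In site `𝕋` Harris–FKG glues the two sides of a column (black circuits THROUGH the wall around wall segments, simultaneous handles, …);
`twoWallDomination` transfers every such lower bound to every column-mixed pattern, the pinned coincidence at the wall included.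
What it does NOT give (lead c8 report, hugging argument): band-confined or fat (thin-annulus) rings — profile events are blind to
how far from the wall the connecting paths run.
-/

noncomputable section

namespace Summit.CriticalPhenomena.CardyFormulaZ2.Theorems.IKLinearTransport.PinnedDiagramExchange.WallDomination

/-- **ONE-WALL DOMINATION** (registered sub-goal `oneWallDomination`): for every face-type pattern `τ` on the cylinder slab
(`L ≥ 3`) and every wall-monotone event `E`, `cylProb w L (fun _ => false) E ≤ cylProb w L τ E`. -/
theorem oneWallDomination : OneWallDomination :=
  oneWallDomination_of stub_h1Gen stub_linkConstGen stub_permInvariance stub_wallMonotoneOffCol stub_lastColMonoGen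
    stub_lastFaceMonoGen stub_oneWallDomination_of

/-- **TWO-WALL DOMINATION — the FKG substitute across a column** (registered sub-goal `twoWallDomination`): for every face-type
pattern `τ` on the cylinder slab of `w₁ + w₂` face columns (`L ≥ 3`) and every event `E` increasing in the two profiles of the middle
column, `cylProb (w₁ + w₂) L (fun _ => false) E ≤ cylProb (w₁ + w₂) L τ E`. -/
theorem twoWallDomination : TwoWallDomination :=
  twoWallDomination_of stub_h1Gen stub_linkConstGen stub_permInvariance stub_wallMonotoneOffCol stub_lastColMonoGen
    stub_lastFaceMonoGen stub_oneWallDomination_of stub_productStructure stub_rotInvariance stub_twoWallOfOne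

/-! ## Event classes and the headline instances -/

section Events

open Summit.CriticalPhenomena.CardyFormulaZ2.Cruxes.IKMixedBoxCrossing.DefectClosureExploration

variable {w w₁ w₂ L : ℕ}

/-- CONSTRUCTOR: an event read through the wall colouring and the wall profile by a predicate increasing in the profile is
wall-monotone. -/
theorem WallMonotone.of_monotone (Ψ : (ZMod L → Bool) → Set (ZMod L × ZMod L) → Prop)
    (hΨ : ∀ ξ R R', R ⊆ R' → Ψ ξ R → Ψ ξ R') :
    WallMonotone {x : CylCfg w L | Ψ (wallCol x) (wallRel x)} :=
  fun x y hc hr hx => by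
    simp only [Set.mem_setOf_eq] at hx ⊢
    rw [← hc]
    exact hΨ _ _ _ hr hx

/-- CONSTRUCTOR: an event read through the middle colouring and the two profiles by a predicate increasing in both profiles is
two-wall-monotone. -/
theorem TwoWallMonotone.of_monotone (Ψ : (ZMod L → Bool) → Set (ZMod L × ZMod L) → Set (ZMod L × ZMod L) → Prop)
    (hΨ : ∀ ξ R R' S S', R ⊆ R' → S ⊆ S' → Ψ ξ R S → Ψ ξ R' S') :
    TwoWallMonotone w₁ w₂ {x : CylCfg (w₁ + w₂) L | Ψ (midCol w₁ w₂ x) (leftRel w₁ w₂ x) (rightRel w₁ w₂ x)} :=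
  fun x y hc hl hr hx => by
    simp only [Set.mem_setOf_eq] at hx ⊢
    rw [← hc]
    exact hΨ _ _ _ _ _ hl hr hx

/-- THE THIN-RING EVENT of the middle column `w₁`: some middle cell with row in `A` and some middle cell with row in `B` are joined by a black
path inside the LEFT part and by a black path inside the RIGHT part (a black circuit through the wall; on `𝕋` its probability is bounded below by
RSW and Harris).  Optionally cut down by an event `Ξ` of the middle colouring. -/
def thinRing (w₁ w₂ : ℕ) (Ξ : Set (ZMod L → Bool)) (A B : Set (ZMod L)) : Set (CylCfg (w₁ + w₂) L) :=
  {x | midCol w₁ w₂ x ∈ Ξ ∧ ∃ r ∈ A, ∃ s ∈ B, (r, s) ∈ leftRel w₁ w₂ x ∧ (r, s) ∈ rightRel w₁ w₂ x}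

/-- The thin-ring event is two-wall-monotone. -/
theorem twoWallMonotone_thinRing (Ξ : Set (ZMod L → Bool)) (A B : Set (ZMod L)) :
    TwoWallMonotone w₁ w₂ (thinRing (L := L) w₁ w₂ Ξ A B) :=
  fun _ _ hc hl hr ⟨hΞ, r, hrA, s, hsB, h1, h2⟩ => ⟨hc ▸ hΞ, r, hrA, s, hsB, hl h1, hr h2⟩

/-- **THIN RINGS THROUGH THE WALL ARE AT LEAST AS LIKELY AS ON `𝕋`, for every pattern and conditionally on the wall**:
`cylProb hon (thinRing Ξ A B) ≤ cylProb τ (thinRing Ξ A B)`. -/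
theorem thinRing_domination [NeZero L] (hL : 3 ≤ L) (τ : Fin (w₁ + w₂) → Bool) (Ξ : Set (ZMod L → Bool)) (A B : Set (ZMod L)) :
    cylProb (w₁ + w₂) L (fun _ => false) (thinRing w₁ w₂ Ξ A B) ≤ cylProb (w₁ + w₂) L τ (thinRing w₁ w₂ Ξ A B) :=
  twoWallDomination w₁ w₂ L hL τ _ (twoWallMonotone_thinRing Ξ A B)

/-- SIMULTANEOUS HANDLES on one side of the wall: every pair of arcs in the family `𝓕` is joined inside the slab, cut down by an event `Ξ` of the
wall colouring. -/
def handles (w : ℕ) (Ξ : Set (ZMod L → Bool)) (𝓕 : Set (Set (ZMod L) × Set (ZMod L))) : Set (CylCfg w L) :=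
  {x | wallCol x ∈ Ξ ∧ ∀ p ∈ 𝓕, ∃ r ∈ p.1, ∃ s ∈ p.2, (r, s) ∈ wallRel x}

/-- The simultaneous-handles event is wall-monotone. -/
theorem wallMonotone_handles (Ξ : Set (ZMod L → Bool)) (𝓕 : Set (Set (ZMod L) × Set (ZMod L))) :
    WallMonotone (handles (L := L) w Ξ 𝓕) :=
  fun _ _ hc hr ⟨hΞ, h⟩ => ⟨hc ▸ hΞ, fun p hp => by
    obtain ⟨r, hr1, s, hs1, hrs⟩ := h p hp
    exact ⟨r, hr1, s, hs1, hr hrs⟩⟩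

/-- **SIMULTANEOUS HANDLES ARE AT LEAST AS LIKELY AS ON `𝕋`, for every pattern and conditionally on the wall** (the one-sided FKG
substitute: on `𝕋` Harris bounds the joint probability below by the product). -/
theorem handles_domination [NeZero L] (hL : 3 ≤ L) (τ : Fin w → Bool) (Ξ : Set (ZMod L → Bool))
    (𝓕 : Set (Set (ZMod L) × Set (ZMod L))) :
    cylProb w L (fun _ => false) (handles w Ξ 𝓕) ≤ cylProb w L τ (handles w Ξ 𝓕) :=
  oneWallDomination w L hL τ _ (wallMonotone_handles Ξ 𝓕)

end Events

end Summit.CriticalPhenomena.CardyFormulaZ2.Theorems.IKLinearTransport.PinnedDiagramExchange.WallDomination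

end
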